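import Summits.ABC.ABC.Theses.PadicPrimesKummerThird
import Literature.NumberTheory.Transcendental.Nesterenko2003Prop51Holds
import Summits.ABC.StewartYu.YuOhSevenTransferTwo
import Summits.ABC.StewartYu.GenThreeFramePivotTwo
import Summits.ABC.StewartYu.PadicG3TwoClose
import HarnessLib

/-! # Crux `Y07Two` (stmt-ABC-19659) of route `PadicPrimesKummerThird` — CLOSED (line `gen3-zero-estimate-end-two`)

The Yu-2007-quality `2`-adic bound for sets of odd rational primes,
`ord₂(∏ q^{e_q} − 1)·log 2 < c₆^{#S}·(2/log 2)·(log 2 + log B + log log A)·∏ log q`,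
as a sorry-free consequence of the cell's Gen-3 `2`-adic frame (Yu's `q = 3` Kummer descent on the slab class,
Nesterenko's pre-scaled Fel'dman basis, the shared zero estimate `Nesterenko2003_prop51_holds`):

* `stub_frameTwoLast` — the registered stub of the crux skeleton, by `Summit.ABC.StewartYu.TwoSetup.frameTwoLast_all`
  (`PadicG3TwoClose`: engine constant `C m = 2^{110 m}`; schedule of record `schedTwoS` and its numerics / END block /
  datum package (p5), budget lines (L2₀)/(L2)/(L3ᴿ), first branches and headline (p3), record `RecordTwo` by name
  (lp-1 `RecordNumericC` on p4's `RecordAssembly`), parameter ledger `PadicG3Par` (p1), level `0` (L1) (p1/p5));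
* `Y07Two_proof` — the crux BY NAME: Matveev induction shell `GenThreeFramePivotTwo.engineTwo_of_frameLast_two_le`
  (p3-g5) at the zero estimate `Nesterenko2003_prop51_holds` (p5/lp-1), then the transfer
  `YuOhSeven.y07Two_of_genThreeEngineTwo` (p1, `αⱼ = qⱼ²`, `c₆ = 3c₁`).

Cell abc-stewartyu (HOME `run/shared/lean/pub/abc-stewartyu/`), F-two lead p3 (g4 → g5 → g6).
-/

namespace Summit.ABC.ABC.Theorems

open Summit.ABC.ABC.Theses.PadicPrimesKummerThird
open Literature.NumberTheory.Transcendental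

/-- **The registered stub `stub_frameTwoLast` of crux stmt-ABC-19659** (line `gen3-zero-estimate-end-two`): an
admissible engine constant `C ≤ c₁ⁿ`, `4 ≤ C 1`, and under the zero estimate the analytic frame for pivot-last data at
every rank `d + 1 ≥ 2`. [cite: Yu2007, Main Thm (K = ℚ, ℘ = 2); shape only] -/
theorem stub_frameTwoLast :
    ∃ (C : ℕ → ℝ) (c₁ : ℝ), 1 ≤ c₁ ∧ (∀ m, 0 ≤ C m ∧ C m ≤ c₁ ^ m) ∧ 4 ≤ C 1 ∧
      (Nesterenko2003_prop51 → ∀ d, 1 ≤ d → Summit.ABC.StewartYu.GenThreeFramePivotTwo.FrameTwoLast C d) :=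
  Summit.ABC.StewartYu.TwoSetup.frameTwoLast_all

/-- **CRUX `Y07Two` OF ROUTE `PadicPrimesKummerThird`** — Yu's 2007 `p`-adic bound at `p = 2` over `ℚ` for sets of
odd primes, in the kernel: frame (`stub_frameTwoLast`) → Gen-3 engine at `p = 2` (Matveev induction on the rank at the
zero estimate `Nesterenko2003_prop51_holds`) → the crux text (`αⱼ = qⱼ²`). [cite: Yu2007, Main Thm (K = ℚ, ℘ = 2)] -/
theorem Y07Two_proof : Y07Two := by
  obtain ⟨C, c₁, hc₁, hC, hC1, hF⟩ := stub_frameTwoLast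
  exact Summit.ABC.StewartYu.YuOhSeven.y07Two_of_genThreeEngineTwo
    (Summit.ABC.StewartYu.GenThreeFramePivotTwo.engineTwo_of_frameLast_two_le hc₁ hC hC1 hF
      Nesterenko2003_prop51_holds)

end Summit.ABC.ABC.Theorems
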